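import Summits.MatrixMultiplication.MatrixMultiplication.Theorems.SoloBlindMixedWindows345
import Summits.MatrixMultiplication.MatrixMultiplication.Theorems.SoloBlindCubeKoszul920
import Mathlib.Tactic.NormNum.Prime
import HarnessLib

/-!
# Mixed Kronecker words in `{T_{cw,2}, T_{skewcw,2}}`: the rest of the `k = 5` window and three `k = 6` words

`Summits/MatrixMultiplication/MatrixMultiplication/Theorems` (soloist file, blind arm, session s39; sequel of
`SoloBlindMixedWindows345.lean`).

With `T = T_{cw,2}`, `E = T_{skewcw,2}` and the ω-window thresholds `β^5 = 373.11`, `β^6 = 1219.55`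
(`β = 3.268635`; a word `W` of length `k` could improve `ω < 2.371177` through the laser method only if
`bR(W) < β^k`), this file proves

* `soloTE_kron_cw_skewSq_ge`  : `396 ≤ bR((T ⊠ E) ⊠ (T ⊠ E^{⊠2}))`   — the word `T²E³`, `k = 5`;
* `soloEE_kron_cw_skewSq_ge`  : `378 ≤ bR((E ⊠ E) ⊠ (T ⊠ E^{⊠2}))`   — the word `TE⁴`,  `k = 5`;
* `soloE3_kron_cwPow_ge N`    : `941 · 3^N ≤ 20 · bR(E^{⊠3} ⊠ T^{⊠N})`, so `bR(T³E³) ≥ 1271` (`N = 3`);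
* `soloE3_kron_cw_skewSq_ge`  : `1271 ≤ bR(E^{⊠3} ⊠ (T ⊠ E^{⊠2}))`   — the word `TE⁵`,  `k = 6`;
* `soloT3_kron_cw_skewSq_ge`  : `1242 ≤ bR(T^{⊠3} ⊠ (T ⊠ E^{⊠2}))`   — the word `T⁴E²`, `k = 6`.

Together with `SoloBlindMixedWindows345` (`T⁴E ≥ 396`, `T³E² ≥ 378`) and the pure fifth powers in the tree,
EVERY mixed word of length `5` is outside its ω-window in the kernel.  At length `6` the words `T⁵E` and
`T²E⁴` remain (numerically `≥ 1367` and `≥ 1333`; a kernel proof needs a `(7,3)` certificate of `T²E`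
resp. `TE²`).

## Method

The only new ingredient is the (folklore) closure of `1_A`-genericity under Kronecker products
(`isOneAGeneric_kroneckerTensor`: `(t₁ ⊠ t₂)(α₁ ⊗ α₂) = t₁(α₁) ⊗ t₂(α₂)` and matrix rank is multiplicative),
which makes the cofactors `X ⊠ E^{⊠2}` and `X^{⊠N} ⊠ E^{⊠2}` (`X ≅ T`, `E^{⊠2} ≅ det₃`) `1_A`-generic of
size `27` resp. `9 · 3^N` although `E` itself is not (`E(α)` is a skew `3 × 3` matrix).  The numerators are
the certified Koszul ranks already in the tree: `88` (`soloTE_koszulRank_ge'`, base `T ⊠ E`), `84`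
(`soloEE_koszulRank_ge'`, base `E ⊠ E`), `941` (`soloLc_rank_three`, base `E^{⊠3}`, `p = 3`) and `920`
(`soloK920_cube_koszulRank_ge`, base `T^{⊠3}`, `p = 3`); propagation is CGLV Prop. 3.2
(`CGLV2022_prop32_of_isOneAGeneric`) and transport to the tree's tensors is by restriction.

References: Conner, Gesmundo, Landsberg, Ventura, *Rank and border rank of Kronecker powers of tensors and
Strassen's laser method*, comput. complexity 31 (2022), Prop. 3.2, §3.2 [ConnerGesmundoLandsbergVentura2022];
Landsberg–Ottaviani, Theory Comput. 11 (2015) (Koszul flattenings) [LandsbergOttaviani2015].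
-/

namespace Summit.MatrixMultiplication.MatrixMultiplication.Theorems

open Matrix
open Literature.Computability.AlgebraicComplexity

/-! ## `1_A`-genericity is closed under Kronecker products -/

/-- `(t₁ ⊠ t₂)(α₁ ⊗ α₂) = t₁(α₁) ⊗ t₂(α₂)` as matrices. [folklore] -/
theorem contractFirst_kroneckerTensor {K : Type*} [CommSemiring K] {ι₁ κ₁ μ₁ ι₂ κ₂ μ₂ : Type*}
    [Fintype ι₁] [Fintype ι₂] (α₁ : ι₁ → K) (α₂ : ι₂ → K) (t₁ : ι₁ → κ₁ → μ₁ → K)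
    (t₂ : ι₂ → κ₂ → μ₂ → K) :
    contractFirst (fun a : ι₁ × ι₂ => α₁ a.1 * α₂ a.2) (kroneckerTensor t₁ t₂) =
      Matrix.kroneckerMap (· * ·) (contractFirst α₁ t₁) (contractFirst α₂ t₂) := by
  ext b c
  simp only [contractFirst_apply, kroneckerTensor_apply, Matrix.kroneckerMap_apply]
  rw [Fintype.sum_prod_type, Finset.sum_mul_sum]
  refine Finset.sum_congr rfl fun a₁ _ => Finset.sum_congr rfl fun a₂ _ => ?_
  ring

/-- **Kronecker products of `1_A`-generic tensors are `1_A`-generic** (witness `α₁ ⊗ α₂`). [folklore;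
cite: ConnerGesmundoLandsbergVentura2022, §3.2] -/
theorem isOneAGeneric_kroneckerTensor {K : Type*} [Field K] {ι₁ κ₁ μ₁ ι₂ κ₂ μ₂ : Type*}
    [Fintype ι₁] [Fintype κ₁] [Fintype μ₁] [Fintype ι₂] [Fintype κ₂] [Fintype μ₂] [DecidableEq μ₁]
    [DecidableEq μ₂] {t₁ : ι₁ → κ₁ → μ₁ → K} {t₂ : ι₂ → κ₂ → μ₂ → K} (h₁ : IsOneAGeneric t₁)
    (h₂ : IsOneAGeneric t₂) : IsOneAGeneric (kroneckerTensor t₁ t₂) := by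
  obtain ⟨hc₁, α₁, hr₁⟩ := h₁
  obtain ⟨hc₂, α₂, hr₂⟩ := h₂
  refine ⟨by rw [Fintype.card_prod, Fintype.card_prod, hc₁, hc₂], fun a => α₁ a.1 * α₂ a.2, ?_⟩
  rw [contractFirst_kroneckerTensor, matRank_kroneckerMap_mul, hr₁, hr₂, Fintype.card_prod]

/-- `X` (`X(1,1,1) = J − I` invertible) is `1_A`-generic. [new] -/
theorem isOneAGeneric_xyzTensor : IsOneAGeneric (xyzTensor ℂ) :=
  ⟨rfl, fun _ => 1, by rw [Matrix.rank_of_isUnit _ isUnit_contractFirst_xyzTensor, Fintype.card_fin]⟩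

/-- The cofactor `X ⊠ E^{⊠2}` (`≅ T_{cw,2} ⊠ det₃`, size `27`) is `1_A`-generic. [new] -/
theorem isOneAGeneric_xyz_lcSq :
    IsOneAGeneric (kroneckerTensor (xyzTensor ℂ) (kroneckerPow (lcTensor ℂ) 2)) :=
  isOneAGeneric_kroneckerTensor isOneAGeneric_xyzTensor isOneAGeneric_kroneckerPow_lc_two

/-- The cofactor `X^{⊠N} ⊠ E^{⊠2}` (size `3^N · 9`) is `1_A`-generic. [new] -/
theorem isOneAGeneric_xyzPow_lcSq (N : ℕ) :
    IsOneAGeneric (kroneckerTensor (kroneckerPow (xyzTensor ℂ) N) (kroneckerPow (lcTensor ℂ) 2)) :=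
  isOneAGeneric_kroneckerTensor (isOneAGeneric_kroneckerPow (xyzTensor ℂ) isUnit_contractFirst_xyzTensor N)
    isOneAGeneric_kroneckerPow_lc_two

/-! ## `k = 5`: the words `T²E³` and `TE⁴` -/

/-- **`396 ≤ bR((T_{cw,2} ⊠ T_{skewcw,2}) ⊠ (T_{cw,2} ⊠ T_{skewcw,2}^{⊠2}))`** (`88 · 27 = 6 · 396`): the word
`T²E³` is outside the `k = 5` window (`373.11`). [new] -/
theorem soloTE_kron_cw_skewSq_ge :
    396 ≤ algBorderRank (kroneckerTensor (kroneckerTensor (cwTensor ℂ 2) (skewCwTensor ℂ 1))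
      (kroneckerTensor (cwTensor ℂ 2) (kroneckerPow (skewCwTensor ℂ 1) 2))) := by
  have key := CGLV2022_prop32_of_isOneAGeneric 2 (soloTEPhi.map (Int.castRingHom ℂ)).mulVecLin soloMixC
    isOneAGeneric_xyz_lcSq
  have hcard : Fintype.card (Fin 3 × (Fin 2 → Fin 3)) = 27 := by
    norm_num [Fintype.card_prod, Fintype.card_fun, Fintype.card_fin]
  rw [hcard, show Nat.choose (2 * 2) 2 = 6 by decide] at key
  have hres : TensorRestrictsTo
      (kroneckerTensor (kroneckerTensor (cwTensor ℂ 2) (skewCwTensor ℂ 1))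
        (kroneckerTensor (cwTensor ℂ 2) (kroneckerPow (skewCwTensor ℂ 1) 2)))
      (kroneckerTensor soloMixC (kroneckerTensor (xyzTensor ℂ) (kroneckerPow (lcTensor ℂ) 2))) :=
    soloMix_restrictsTo.kronecker
      (tensorRestrictsTo_cwTensor_xyzTensor.kronecker (tensorRestrictsTo_skewCwTensor_lcTensor.kroneckerPow 2))
  have h := ((Nat.mul_le_mul_right 27 soloTE_koszulRank_ge').trans key).trans
    (Nat.mul_le_mul_left 6 hres.algBorderRank_le)
  omega

/-- **`378 ≤ bR((T_{skewcw,2} ⊠ T_{skewcw,2}) ⊠ (T_{cw,2} ⊠ T_{skewcw,2}^{⊠2}))`** (`84 · 27 = 6 · 378`): the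
word `TE⁴` is outside the `k = 5` window (`373.11`). [new] -/
theorem soloEE_kron_cw_skewSq_ge :
    378 ≤ algBorderRank (kroneckerTensor (kroneckerTensor (skewCwTensor ℂ 1) (skewCwTensor ℂ 1))
      (kroneckerTensor (cwTensor ℂ 2) (kroneckerPow (skewCwTensor ℂ 1) 2))) := by
  have key := CGLV2022_prop32_of_isOneAGeneric 2 (soloEEPhi.map (Int.castRingHom ℂ)).mulVecLin soloDetC
    isOneAGeneric_xyz_lcSq
  have hcard : Fintype.card (Fin 3 × (Fin 2 → Fin 3)) = 27 := by
    norm_num [Fintype.card_prod, Fintype.card_fun, Fintype.card_fin]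
  rw [hcard, show Nat.choose (2 * 2) 2 = 6 by decide] at key
  have hres : TensorRestrictsTo
      (kroneckerTensor (kroneckerTensor (skewCwTensor ℂ 1) (skewCwTensor ℂ 1))
        (kroneckerTensor (cwTensor ℂ 2) (kroneckerPow (skewCwTensor ℂ 1) 2)))
      (kroneckerTensor soloDetC (kroneckerTensor (xyzTensor ℂ) (kroneckerPow (lcTensor ℂ) 2))) :=
    soloDet_restrictsTo.kronecker
      (tensorRestrictsTo_cwTensor_xyzTensor.kronecker (tensorRestrictsTo_skewCwTensor_lcTensor.kroneckerPow 2))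
  have h := ((Nat.mul_le_mul_right 27 soloEE_koszulRank_ge').trans key).trans
    (Nat.mul_le_mul_left 6 hres.algBorderRank_le)
  omega

/-! ## `k = 6`: the words `T³E³`, `TE⁵`, `T⁴E²` (from the `p = 3` cube certificates `941` and `920`) -/

/-- **`941 · 3^N ≤ 20 · bR(T_{skewcw,2}^{⊠3} ⊠ T_{cw,2}^{⊠N})`**; for `N = 3`: `bR(T³E³) ≥ 1271 > 1219.55`.
[new] -/
theorem soloE3_kron_cwPow_ge (N : ℕ) :
    941 * 3 ^ N ≤ 20 * algBorderRank
      (kroneckerTensor (kroneckerPow (skewCwTensor ℂ 1) 3) (kroneckerPow (cwTensor ℂ 2) N)) := by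
  have key := CGLV2022_prop32_of_isOneAGeneric 3 soloLcMArrow.mulVecLin (kroneckerPow (lcTensor ℂ) 3)
    (isOneAGeneric_kroneckerPow (xyzTensor ℂ) isUnit_contractFirst_xyzTensor N)
  rw [Fintype.card_fun, Fintype.card_fin, Fintype.card_fin, show Nat.choose (2 * 3) 3 = 20 by decide] at key
  have hres : TensorRestrictsTo
      (kroneckerTensor (kroneckerPow (skewCwTensor ℂ 1) 3) (kroneckerPow (cwTensor ℂ 2) N))
      (kroneckerTensor (kroneckerPow (lcTensor ℂ) 3) (kroneckerPow (xyzTensor ℂ) N)) :=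
    (tensorRestrictsTo_skewCwTensor_lcTensor.kroneckerPow 3).kronecker
      (tensorRestrictsTo_cwTensor_xyzTensor.kroneckerPow N)
  exact ((Nat.mul_le_mul_right (3 ^ N) soloLc_rank_three).trans key).trans
    (Nat.mul_le_mul_left 20 hres.algBorderRank_le)

/-- `bR(T_{skewcw,2}^{⊠3} ⊠ T_{cw,2}^{⊠3}) ≥ 1271` (`941 · 27 = 25407 > 20 · 1270`): the word `T³E³` is outside
the `k = 6` window. [new] -/
theorem soloE3_kron_cwPow_three_ge :
    1271 ≤ algBorderRank
      (kroneckerTensor (kroneckerPow (skewCwTensor ℂ 1) 3) (kroneckerPow (cwTensor ℂ 2) 3)) := by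
  have h := soloE3_kron_cwPow_ge 3
  omega

/-- **`1271 ≤ bR(T_{skewcw,2}^{⊠3} ⊠ (T_{cw,2} ⊠ T_{skewcw,2}^{⊠2}))`**: the word `TE⁵` is outside the `k = 6`
window (`1219.55`). [new] -/
theorem soloE3_kron_cw_skewSq_ge :
    1271 ≤ algBorderRank (kroneckerTensor (kroneckerPow (skewCwTensor ℂ 1) 3)
      (kroneckerTensor (cwTensor ℂ 2) (kroneckerPow (skewCwTensor ℂ 1) 2))) := by
  have key := CGLV2022_prop32_of_isOneAGeneric 3 soloLcMArrow.mulVecLin (kroneckerPow (lcTensor ℂ) 3)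
    isOneAGeneric_xyz_lcSq
  have hcard : Fintype.card (Fin 3 × (Fin 2 → Fin 3)) = 27 := by
    norm_num [Fintype.card_prod, Fintype.card_fun, Fintype.card_fin]
  rw [hcard, show Nat.choose (2 * 3) 3 = 20 by decide] at key
  have hres : TensorRestrictsTo
      (kroneckerTensor (kroneckerPow (skewCwTensor ℂ 1) 3)
        (kroneckerTensor (cwTensor ℂ 2) (kroneckerPow (skewCwTensor ℂ 1) 2)))
      (kroneckerTensor (kroneckerPow (lcTensor ℂ) 3)
        (kroneckerTensor (xyzTensor ℂ) (kroneckerPow (lcTensor ℂ) 2))) :=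
    (tensorRestrictsTo_skewCwTensor_lcTensor.kroneckerPow 3).kronecker
      (tensorRestrictsTo_cwTensor_xyzTensor.kronecker (tensorRestrictsTo_skewCwTensor_lcTensor.kroneckerPow 2))
  have h := ((Nat.mul_le_mul_right 27 soloLc_rank_three).trans key).trans
    (Nat.mul_le_mul_left 20 hres.algBorderRank_le)
  omega

/-- **`1242 ≤ bR(T_{cw,2}^{⊠3} ⊠ (T_{cw,2} ⊠ T_{skewcw,2}^{⊠2}))`** (`920 · 27 = 20 · 1242`): the word `T⁴E²` is
outside the `k = 6` window (`1219.55`). [new] -/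
theorem soloT3_kron_cw_skewSq_ge :
    1242 ≤ algBorderRank (kroneckerTensor (kroneckerPow (cwTensor ℂ 2) 3)
      (kroneckerTensor (cwTensor ℂ 2) (kroneckerPow (skewCwTensor ℂ 1) 2))) := by
  have h920 : 920 ≤ (koszulFlattening 3 soloK920MArrow.mulVecLin (kroneckerPow (xyzTensor ℂ) 3)).rank := by
    rw [koszulFlattening_kroneckerPow_three_soloK920_bridge, Matrix.rank_submatrix]
    exact soloK920_cube_koszulRank_ge
  have key := CGLV2022_prop32_of_isOneAGeneric 3 soloK920MArrow.mulVecLin (kroneckerPow (xyzTensor ℂ) 3)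
    isOneAGeneric_xyz_lcSq
  have hcard : Fintype.card (Fin 3 × (Fin 2 → Fin 3)) = 27 := by
    norm_num [Fintype.card_prod, Fintype.card_fun, Fintype.card_fin]
  rw [hcard, show Nat.choose (2 * 3) 3 = 20 by decide] at key
  have hres : TensorRestrictsTo
      (kroneckerTensor (kroneckerPow (cwTensor ℂ 2) 3)
        (kroneckerTensor (cwTensor ℂ 2) (kroneckerPow (skewCwTensor ℂ 1) 2)))
      (kroneckerTensor (kroneckerPow (xyzTensor ℂ) 3)
        (kroneckerTensor (xyzTensor ℂ) (kroneckerPow (lcTensor ℂ) 2))) :=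
    (tensorRestrictsTo_cwTensor_xyzTensor.kroneckerPow 3).kronecker
      (tensorRestrictsTo_cwTensor_xyzTensor.kronecker (tensorRestrictsTo_skewCwTensor_lcTensor.kroneckerPow 2))
  have h := ((Nat.mul_le_mul_right 27 h920).trans key).trans
    (Nat.mul_le_mul_left 20 hres.algBorderRank_le)
  omega

/-- Summary, `k = 5` complete: with `soloMixed_window_five` all four mixed words of length `5` containing a `T`
and at least one `E` are `≥ 374`: `T⁴E ≥ 396`, `T³E² ≥ 378`, `T²E³ ≥ 396`, `TE⁴ ≥ 378`. [new] -/
theorem soloMixed_window_five_complete :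
    396 ≤ algBorderRank (kroneckerTensor (kroneckerTensor (cwTensor ℂ 2) (skewCwTensor ℂ 1))
        (kroneckerPow (cwTensor ℂ 2) 3)) ∧
    378 ≤ algBorderRank (kroneckerTensor (kroneckerTensor (skewCwTensor ℂ 1) (skewCwTensor ℂ 1))
        (kroneckerPow (cwTensor ℂ 2) 3)) ∧
    396 ≤ algBorderRank (kroneckerTensor (kroneckerTensor (cwTensor ℂ 2) (skewCwTensor ℂ 1))
        (kroneckerTensor (cwTensor ℂ 2) (kroneckerPow (skewCwTensor ℂ 1) 2))) ∧
    378 ≤ algBorderRank (kroneckerTensor (kroneckerTensor (skewCwTensor ℂ 1) (skewCwTensor ℂ 1))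
        (kroneckerTensor (cwTensor ℂ 2) (kroneckerPow (skewCwTensor ℂ 1) 2))) :=
  ⟨soloMixed_window_five.1, soloMixed_window_five.2, soloTE_kron_cw_skewSq_ge, soloEE_kron_cw_skewSq_ge⟩

end Summit.MatrixMultiplication.MatrixMultiplication.Theorems
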